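import Literature.MathematicalPhysics.QuantumFieldTheory.QCDTransferMatrix

/-!
# Feature expansion of the powers of the Wilson link Gram kernel
(crux `QuarksAsStableAction.StableActionBridge`, item stmt-QuantumFields-9737, line `Sketch`;
registered stub `linkGram_pow_feature_expansion` of the lead skeleton)

In temporal gauge the one-step Wilson transfer kernel of `SU(3)` lattice gauge theory on the
spatial three-torus of side `S` is `f(U) f(U') e^{−3β|E|} exp(β k(U, U'))` with the LINK GRAM
KERNEL `k(U, U') = ∑ₗ Re tr(U_l U'_lᴴ)` (Smit, *Introduction to Quantum Fields on a Lattice*,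
§4.6). This file proves the purely algebraic FEATURE EXPANSION of its powers: with the real
features `feat (l, a, b, true) V = Re (V_l)_ab`, `feat (l, a, b, false) V = Im (V_l)_ab`,

  `k(U, U') ^ n = ∑_{α : Fin n → E × 3 × 3 × Bool} (∏ₜ feat (α t) U) · (∏ₜ feat (α t) U')`,

a finite sum of PRODUCT kernels `G_α(U) G_α(U')`; this turns the exponential series of `k` into
a sum of manifestly positive quadratic forms (the analysis is done by neighbouring stubs).

Three steps, Mathlib only:
* `Re tr(V Wᴴ) = ∑_{a,b} (Re V_ab · Re W_ab + Im V_ab · Im W_ab)` (`Matrix.trace`,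
  `Matrix.mul_apply`, `Matrix.conjTranspose_apply`, `Complex.mul_re`; the sum over `Bool`
  packages the two terms, `Fintype.sum_bool`), so `k(U, U') = ∑_c feat c U · feat c U'`
  (`Fintype.sum_prod_type`);
* `(∑_c x_c) ^ n = ∑_{α : Fin n → C} ∏ₜ x_{α t}` (`Fintype.sum_pow`);
* `∏ₜ (feat (α t) U · feat (α t) U') = (∏ₜ feat (α t) U) · ∏ₜ feat (α t) U'`
  (`Finset.prod_mul_distrib`).
-/

namespace Summit.QuantumFields.QCD.Cruxes.StableActionBridge.Sketch

open Literature.MathematicalPhysics.QuantumFieldTheory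
open scoped Matrix

/-- Real Frobenius pairing, expanded in matrix entries:
`Re tr(V Wᴴ) = ∑_{a,b} (Re V_ab · Re W_ab + Im V_ab · Im W_ab)` (the real part of
`V_ab · conj W_ab = (x + iy)(p − iq)` is `xp + yq`). [folklore] -/
private theorem re_trace_mul_conjTranspose_expand {N : ℕ} (V W : Matrix (Fin N) (Fin N) ℂ) :
    (V * Wᴴ).trace.re =
      ∑ a : Fin N, ∑ b : Fin N, ((V a b).re * (W a b).re + (V a b).im * (W a b).im) := by
  simp only [Matrix.trace, Matrix.diag_apply, Matrix.mul_apply, Matrix.conjTranspose_apply,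
    Complex.re_sum, Complex.mul_re, Complex.star_def, Complex.conj_re, Complex.conj_im]
  refine Finset.sum_congr rfl fun a _ => Finset.sum_congr rfl fun b _ => ?_
  ring

/-- **Feature expansion of the `n`-th power of the link Gram kernel.** For `SU(3)` gauge
configurations `U, U'` on the edges of the spatial three-torus of side `S`, with the real features
`feat (l, a, b, true) V = Re (V_l)_ab` and `feat (l, a, b, false) V = Im (V_l)_ab`,
`(∑ₗ Re tr(U_l U'_lᴴ)) ^ n = ∑_{α : Fin n → Edge × Fin 3 × Fin 3 × Bool} (∏ₜ feat (α t) U) (∏ₜ feat (α t) U')`: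
expand each `Re tr(U_l U'_lᴴ)` in entries (so the kernel is `∑_c feat c U · feat c U'`), expand
the power of the finite sum as a sum over multi-indices of products (`Fintype.sum_pow`), and split
each product of products (`Finset.prod_mul_distrib`). [folklore] -/
theorem linkGram_pow_feature_expansion : ∀ (S : ℕ) [NeZero S] (n : ℕ) (U U' : GaugeConfig 3 S (Matrix.specialUnitaryGroup (Fin 3) ℂ)), let feat : (Edge 3 S × Fin 3 × Fin 3 × Bool) → GaugeConfig 3 S (Matrix.specialUnitaryGroup (Fin 3) ℂ) → ℝ := fun c V => if c.2.2.2 then ((V c.1 : Matrix (Fin 3) (Fin 3) ℂ) c.2.1 c.2.2.1).re else ((V c.1 : Matrix (Fin 3) (Fin 3) ℂ) c.2.1 c.2.2.1).im; (∑ l : Edge 3 S, ((U l : Matrix (Fin 3) (Fin 3) ℂ) * (U' l : Matrix (Fin 3) (Fin 3) ℂ)ᴴ).trace.re) ^ n = ∑ α : Fin n → (Edge 3 S × Fin 3 × Fin 3 × Bool), (∏ t, feat (α t) U) * (∏ t, feat (α t) U') := by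
  intro S _ n U U' feat
  -- Step 1: the kernel is the sum of the product features.
  have hk : (∑ c : Edge 3 S × Fin 3 × Fin 3 × Bool, feat c U * feat c U') =
      ∑ l : Edge 3 S, ((U l : Matrix (Fin 3) (Fin 3) ℂ) *
        (U' l : Matrix (Fin 3) (Fin 3) ℂ)ᴴ).trace.re := by
    rw [Fintype.sum_prod_type (fun c : Edge 3 S × Fin 3 × Fin 3 × Bool => feat c U * feat c U')]
    refine Finset.sum_congr rfl fun l _ => ?_
    rw [re_trace_mul_conjTranspose_expand,
      Fintype.sum_prod_type (fun c : Fin 3 × Fin 3 × Bool => feat (l, c) U * feat (l, c) U')]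
    refine Finset.sum_congr rfl fun a _ => ?_
    rw [Fintype.sum_prod_type (fun c : Fin 3 × Bool => feat (l, a, c) U * feat (l, a, c) U')]
    refine Finset.sum_congr rfl fun b _ => ?_
    rw [Fintype.sum_bool]
    simp [feat]
  -- Step 2: power of a finite sum = sum over multi-indices of products; Step 3: split products.
  rw [← hk, Fintype.sum_pow]
  refine Finset.sum_congr rfl fun α _ => ?_
  rw [Finset.prod_mul_distrib]

end Summit.QuantumFields.QCD.Cruxes.StableActionBridge.Sketch
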